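import Summits.QuantumAdvantage.QuantumAdvantage.Theorems.LinnikCubicClassGroupsDegreeOnePrimesEscapeOneSidedFrobenius
import HarnessLib

/-!
# One-sided Frobenius classes: the number of primes in the Linnik range

Topic `Summits/QuantumAdvantage/QuantumAdvantage/Theorems`, cell B2b-1 (linnik-cubic), PART A (gen 8);
helper toward the crux `DegreeOnePrimesEscape` (stmt-QuantumAdvantage-11543) of route
`LinnikCubicClassGroups`.  HONEST FRAMING: the value of this file is a THEOREM (kernel-checked, GRH-free,
Siegel-free, no hypothesis) — NOT summit progress.

Quantitative form of `exists_frobenius_mem_of_oneSided` (`…OneSidedFrobenius.lean`): with the same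
one-sided data (`n > 1`, `f₁ > s`, `t`, proper subgroups `H₁,…,H_s` and `C ⊆ Gal(N/ℚ)` with
`f₁ ≤ Σ_i Ind_{H_i} 1 + t·𝟙_C` pointwise), for every `x ≥ |d_N|^L`:

* `frobenius_sum_ge_of_oneSided` — `Σ_{p ≤ x, p ∤ d_N, Frob_p ∈ C} log p ≥ x / (2 max(f₁,t))`;
* `card_frobenius_mem_ge_of_oneSided` — `#{p ≤ x : p ∤ d_N, Frob_p ∈ C} ≥ x / (2 max(f₁,t) log x)`,

a Chebotarev lower bound OF THE RIGHT ORDER in the Linnik range `x ≥ |d_N|^L`, from upper bounds for the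
fixed fields `N^{H_i}` and the prime number theorem only.

References: J. C. Lagarias, H. L. Montgomery, A. M. Odlyzko, Invent. Math. 54 (1979)
[LagariasMontgomeryOdlyzko1979]; J. Thorner, A. Zaman, Algebra Number Theory 13 (2019) [ThornerZaman2019].
-/

noncomputable section

open scoped NumberField nonZeroDivisors
open Finset Real Ideal NumberField
open Literature.NumberTheory.NumberFields Literature.NumberTheory.LFunctions
  Literature.NumberTheory.LFunctions.NumberField

namespace Summit.QuantumAdvantage.QuantumAdvantage.Theorems.DegreeOnePrimesEscape

section OneSidedCount

variable {N : Type} [Field N] [NumberField N] [IsGalois ℚ N]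

/-- `m^m ≤ d^{n²}` for `1 ≤ m ≤ n` and `d ≥ 3`. -/
private theorem pow_self_le_pow_sq'' {m n : ℕ} (hm : m ≤ n) {d : ℝ} (hd : 3 ≤ d) :
    (m : ℝ) ^ m ≤ d ^ (n * n) := by
  have hn : (n : ℝ) ≤ d ^ n := by
    have h1 : (n : ℝ) < 2 ^ n := by exact_mod_cast Nat.lt_two_pow_self
    have h2 : (2 : ℝ) ^ n ≤ d ^ n := pow_le_pow_left₀ (by norm_num) (by linarith) n
    linarith
  have hd1 : (1 : ℝ) ≤ d := by linarith
  calc (m : ℝ) ^ m ≤ (n : ℝ) ^ m := pow_le_pow_left₀ (Nat.cast_nonneg _) (by exact_mod_cast hm) m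
    _ ≤ (d ^ n) ^ m := pow_le_pow_left₀ (Nat.cast_nonneg _) hn m
    _ = d ^ (n * m) := by rw [← pow_mul]
    _ ≤ d ^ (n * n) := pow_le_pow_right₀ hd1 (Nat.mul_le_mul_left n hm)

set_option maxHeartbeats 800000 in
open scoped Classical in
/-- **One-sided classes: the `θ`-count in the Linnik range.**  With the data of
`exists_frobenius_mem_of_oneSided`, for every `x ≥ |d_N|^L`:
`x / (2 max(f₁,t)) ≤ Σ_{p ≤ x, p ∤ d_N, Frob_p ∈ C} log p`. [cite: LagariasMontgomeryOdlyzko1979, Theorem 1.1]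
[cite: ThornerZaman2019, Theorem 1.1] -/
theorem frobenius_sum_ge_of_oneSided (n s f₁ t : ℕ) (hn : 1 < n) (hs : s < f₁) :
    ∃ L : ℝ, 0 < L ∧ ∀ (N : Type) [Field N] [NumberField N] [IsGalois ℚ N],
      Module.finrank ℚ N = n →
      ∀ (H : Fin s → Subgroup (N ≃ₐ[ℚ] N)) (C : Set (N ≃ₐ[ℚ] N)), (∀ i, H i ≠ ⊤) →
        (∀ x : N ≃ₐ[ℚ] N, (f₁ : ℝ) ≤
          ∑ i, (Nat.card {g : N ≃ₐ[ℚ] N // g * x * g⁻¹ ∈ H i} : ℝ) / Nat.card (H i) +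
            (if x ∈ C then (t : ℝ) else 0)) →
        ∀ x : ℝ, ((NumberField.discr N).natAbs : ℝ) ^ L ≤ x →
          x / (2 * max (f₁ : ℝ) t) ≤ ∑ p ∈ (Nat.primesLE ⌊x⌋₊).filter
            (fun p : ℕ => ¬ ((p : ℤ) ∣ NumberField.discr N) ∧
              ∃ (Q : Ideal (𝓞 N)) (_ : Q.IsMaximal) (_ : Q.LiesOver (span {(p : ℤ)}))
                (φ : N ≃ₐ[ℚ] N), IsArithFrobAt ℤ φ Q ∧ Q.inertia (N ≃ₐ[ℚ] N) = ⊥ ∧ φ ∈ C),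
            Real.log p := by
  -- `η` with `η (f₁ + s) ≤ 1/4`
  set η : ℝ := 1 / (4 * ((f₁ : ℝ) + s) + 4) with hη
  have hfs0 : (0 : ℝ) ≤ (f₁ : ℝ) + s := by positivity
  have hη0 : 0 < η := by rw [hη]; positivity
  have hηb : η * ((f₁ : ℝ) + s) ≤ 1 / 4 := by
    rw [hη, div_mul_eq_mul_div, one_mul, div_le_div_iff₀ (by positivity) (by norm_num)]
    nlinarith
  -- uniform upper bounds in every degree `2 ≤ m ≤ n`
  have hdeg : ∀ m : ℕ, ∃ a : ℝ, 1 ≤ a ∧ (1 < m → ∀ (K : Type) [Field K] [NumberField K],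
      Module.finrank ℚ K = m → ∀ x : ℝ, ThornerZaman.condQn K ^ a ≤ x →
        chebyshevThetaIdeal K x ≤ (1 + η) * x) := by
    intro m
    by_cases hm : 1 < m
    · obtain ⟨a, ha, h⟩ := chebyshevThetaIdeal_le_uniform m hm hη0
      exact ⟨a, ha, fun _ => h⟩
    · exact ⟨1, le_rfl, fun h => absurd h hm⟩
  choose a ha hupa using hdeg
  set A : ℝ := ∑ m ∈ Finset.range (n + 1), a m with hA
  have haA : ∀ m ≤ n, a m ≤ A := fun m hm =>
    Finset.single_le_sum (f := a) (fun i _ => le_trans zero_le_one (ha i))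
      (Finset.mem_range.mpr (Nat.lt_succ_of_le hm))
  have hA1 : 1 ≤ A := le_trans (ha 0) (haA 0 (Nat.zero_le n))
  obtain ⟨x₀, hx₀2, hθQ⟩ := chebyshevTheta_eventually_ge hη0
  set c : ℝ := max (f₁ : ℝ) t with hc
  have hc1 : (1 : ℝ) ≤ c := le_trans (by exact_mod_cast (show 1 ≤ f₁ by omega)) (le_max_left _ _)
  have hc0 : 0 < c := by linarith
  obtain ⟨L, hL, hthr⟩ :=
    exists_exponent_rpow (1 + (n : ℝ) * n) A x₀ (4 * c) (by positivity) (by linarith)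
  refine ⟨L, hL, fun N _ _ _ hN H C hH hpt x hxL => ?_⟩
  -- sizes
  set d : ℝ := ((NumberField.discr N).natAbs : ℝ) with hd
  have hd3 : (3 : ℝ) ≤ d := three_le_natAbs_discr_real N (by rw [hN]; exact hn)
  have hd0 : (0 : ℝ) < d := by linarith
  have hd1 : (1 : ℝ) ≤ d := by linarith
  obtain ⟨hx₀, hxQ, hxB⟩ := hthr d hd3
  have hx0 : 0 ≤ x := le_trans (by positivity) hxL
  -- the fixed fields
  have hE : ∀ i, degreeOneTheta (IntermediateField.fixedField (H i)) x ≤ (1 + η) * x := by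
    intro i
    have hgt := one_lt_finrank_fixedField_of_ne_top (H i) (hH i)
    have hle : Module.finrank ℚ (IntermediateField.fixedField (H i)) ≤ n := by
      have h2 := Module.finrank_mul_finrank ℚ (IntermediateField.fixedField (H i)) N
      rw [hN] at h2
      have hpos : 0 < Module.finrank (IntermediateField.fixedField (H i)) N := Module.finrank_pos
      exact le_of_le_of_eq (Nat.le_mul_of_pos_right _ hpos) h2
    have hdE : ((NumberField.discr (IntermediateField.fixedField (H i))).natAbs : ℝ) ≤ d := by
      have hdvd := NumberField.discr_dvd_discr (IntermediateField.fixedField (H i)) N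
      rw [hd]
      exact_mod_cast Nat.le_of_dvd (Int.natAbs_pos.mpr (NumberField.discr_ne_zero N))
        (Int.natAbs_dvd_natAbs.mpr hdvd)
    have hQ : ThornerZaman.condQn (IntermediateField.fixedField (H i)) ≤ d ^ ((1 : ℝ) + n * n) := by
      rw [ThornerZaman.condQn, ← Int.cast_abs, Int.abs_eq_natAbs, Int.cast_natCast,
        show (1 : ℝ) + n * n = (((1 + n * n : ℕ)) : ℝ) by push_cast; ring, Real.rpow_natCast,
        pow_add, pow_one]
      exact mul_le_mul hdE (pow_self_le_pow_sq'' hle hd3) (by positivity) hd0.le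
    have hQ0 : 0 ≤ ThornerZaman.condQn (IntermediateField.fixedField (H i)) := by
      rw [ThornerZaman.condQn]; positivity
    have hdp : (1 : ℝ) ≤ d ^ ((1 : ℝ) + n * n) := Real.one_le_rpow hd1 (by positivity)
    have hQa : ThornerZaman.condQn (IntermediateField.fixedField (H i)) ^
        a (Module.finrank ℚ (IntermediateField.fixedField (H i))) ≤ x :=
      calc _ ≤ (d ^ ((1 : ℝ) + n * n)) ^ a (Module.finrank ℚ (IntermediateField.fixedField (H i))) :=
            Real.rpow_le_rpow hQ0 hQ (le_trans zero_le_one (ha _))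
        _ ≤ (d ^ ((1 : ℝ) + n * n)) ^ A := Real.rpow_le_rpow_of_exponent_le hdp (haA _ hle)
        _ ≤ d ^ L := hxQ
        _ ≤ x := hxL
    exact (degreeOneTheta_le_chebyshevThetaIdeal _ x).trans
      (hupa _ hgt (IntermediateField.fixedField (H i)) rfl x hQa)
  have hsumE : ∑ i, degreeOneTheta (IntermediateField.fixedField (H i)) x ≤ s * ((1 + η) * x) := by
    have h := Finset.sum_le_card_nsmul (Finset.univ : Finset (Fin s))
      (fun i => degreeOneTheta (IntermediateField.fixedField (H i)) x) ((1 + η) * x) (fun i _ => hE i)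
    rwa [Finset.card_univ, Fintype.card_fin, nsmul_eq_mul] at h
  -- the analytic inputs
  have hθ : (1 - η) * x ≤ Chebyshev.theta x := hθQ x (hx₀.trans hxL)
  have hlog : c * Real.log d ≤ x / 4 := by
    have hlogd : Real.log d ≤ d := (Real.log_le_sub_one_of_pos hd0).trans (by linarith)
    have := mul_le_mul_of_nonneg_left hlogd hc0.le
    linarith
  -- the one-sided sum
  have hsum := oneSided_sum_ge H C f₁ t hpt
    (fun p => ∃ (Q : Ideal (𝓞 N)) (_ : Q.IsMaximal) (_ : Q.LiesOver (span {(p : ℤ)}))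
      (φ : N ≃ₐ[ℚ] N), IsArithFrobAt ℤ φ Q ∧ Q.inertia (N ≃ₐ[ℚ] N) = ⊥ ∧ φ ∈ C)
    (fun p _ Q _ _ φ hφ hI hC => ⟨Q, ‹_›, ‹_›, φ, hφ, hI, hC⟩) x
  have hf₁θ : (f₁ : ℝ) * ((1 - η) * x) ≤ f₁ * Chebyshev.theta x :=
    mul_le_mul_of_nonneg_left hθ (Nat.cast_nonneg _)
  have h1 : (1 : ℝ) ≤ (f₁ : ℝ) - s := by
    have : s + 1 ≤ f₁ := hs
    have : ((s : ℝ) + 1) ≤ f₁ := by exact_mod_cast this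
    linarith
  have hcoef : (3 / 4 : ℝ) ≤ ((f₁ : ℝ) - s) - η * ((f₁ : ℝ) + s) := by linarith
  have hmain : 3 / 4 * x ≤ (f₁ : ℝ) * ((1 - η) * x) - s * ((1 + η) * x) := by
    have := mul_le_mul_of_nonneg_right hcoef hx0
    have e : (((f₁ : ℝ) - s) - η * ((f₁ : ℝ) + s)) * x =
        (f₁ : ℝ) * ((1 - η) * x) - s * ((1 + η) * x) := by ring
    linarith
  rw [hd] at hlog
  rw [div_le_iff₀ (by positivity)]
  have h2 : x / 2 ≤ c * ∑ p ∈ (Nat.primesLE ⌊x⌋₊).filter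
      (fun p : ℕ => ¬ ((p : ℤ) ∣ NumberField.discr N) ∧
        ∃ (Q : Ideal (𝓞 N)) (_ : Q.IsMaximal) (_ : Q.LiesOver (span {(p : ℤ)})) (φ : N ≃ₐ[ℚ] N),
          IsArithFrobAt ℤ φ Q ∧ Q.inertia (N ≃ₐ[ℚ] N) = ⊥ ∧ φ ∈ C), Real.log p := by
    linarith
  linarith

/-- `Σ_{p ∈ F} log p ≤ #F · log x` for a set `F` of primes `p ≤ x`. -/
private theorem sum_log_le_card_mul_log' {x : ℝ} (hx : 1 ≤ x) (F : Finset ℕ)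
    (hF : F ⊆ Nat.primesLE ⌊x⌋₊) : ∑ p ∈ F, Real.log p ≤ F.card * Real.log x := by
  have h : ∀ p ∈ F, Real.log p ≤ Real.log x := by
    intro p hp
    have hp := Nat.mem_primesLE.mp (hF hp)
    have hp0 : (0 : ℝ) < p := by exact_mod_cast hp.2.pos
    have hpx : (p : ℝ) ≤ x := (Nat.cast_le.mpr hp.1).trans (Nat.floor_le (by linarith))
    exact Real.log_le_log hp0 hpx
  have := Finset.sum_le_card_nsmul F (fun p => Real.log p) (Real.log x) h
  rwa [nsmul_eq_mul] at this

open scoped Classical in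
/-- **One-sided classes: a Chebotarev lower bound of the right order in the Linnik range** (`π`-count):
with the data of `exists_frobenius_mem_of_oneSided`, for every `x ≥ |d_N|^L`,
`#{p ≤ x : p ∤ d_N, Frob_p ∈ C} ≥ x / (2 max(f₁,t) log x)`, unconditionally.
[cite: LagariasMontgomeryOdlyzko1979, Theorem 1.1] [cite: ThornerZaman2019, Theorem 1.1] -/
theorem card_frobenius_mem_ge_of_oneSided (n s f₁ t : ℕ) (hn : 1 < n) (hs : s < f₁) :
    ∃ L : ℝ, 0 < L ∧ ∀ (N : Type) [Field N] [NumberField N] [IsGalois ℚ N],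
      Module.finrank ℚ N = n →
      ∀ (H : Fin s → Subgroup (N ≃ₐ[ℚ] N)) (C : Set (N ≃ₐ[ℚ] N)), (∀ i, H i ≠ ⊤) →
        (∀ x : N ≃ₐ[ℚ] N, (f₁ : ℝ) ≤
          ∑ i, (Nat.card {g : N ≃ₐ[ℚ] N // g * x * g⁻¹ ∈ H i} : ℝ) / Nat.card (H i) +
            (if x ∈ C then (t : ℝ) else 0)) →
        ∀ x : ℝ, ((NumberField.discr N).natAbs : ℝ) ^ L ≤ x →
          x / (2 * max (f₁ : ℝ) t * Real.log x) ≤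
            (((Nat.primesLE ⌊x⌋₊).filter
              (fun p : ℕ => ¬ ((p : ℤ) ∣ NumberField.discr N) ∧
                ∃ (Q : Ideal (𝓞 N)) (_ : Q.IsMaximal) (_ : Q.LiesOver (span {(p : ℤ)}))
                  (φ : N ≃ₐ[ℚ] N), IsArithFrobAt ℤ φ Q ∧ Q.inertia (N ≃ₐ[ℚ] N) = ⊥ ∧ φ ∈ C)).card : ℝ) := by
  obtain ⟨L, hL, h⟩ := frobenius_sum_ge_of_oneSided n s f₁ t hn hs
  refine ⟨L, hL, fun N _ _ _ hN H C hH hpt x hxL => ?_⟩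
  have hsum := h N hN H C hH hpt x hxL
  have hd3 : (3 : ℝ) ≤ ((NumberField.discr N).natAbs : ℝ) :=
    three_le_natAbs_discr_real N (by rw [hN]; exact hn)
  have hx1 : 1 < x := by
    have h3L : (1 : ℝ) < ((NumberField.discr N).natAbs : ℝ) ^ L := Real.one_lt_rpow (by linarith) hL
    linarith
  have hlog : 0 < Real.log x := Real.log_pos hx1
  have hc0 : 0 < max (f₁ : ℝ) t :=
    lt_of_lt_of_le (by exact_mod_cast (show 0 < f₁ by omega)) (le_max_left _ _)
  set F := (Nat.primesLE ⌊x⌋₊).filter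
    (fun p : ℕ => ¬ ((p : ℤ) ∣ NumberField.discr N) ∧
      ∃ (Q : Ideal (𝓞 N)) (_ : Q.IsMaximal) (_ : Q.LiesOver (span {(p : ℤ)}))
        (φ : N ≃ₐ[ℚ] N), IsArithFrobAt ℤ φ Q ∧ Q.inertia (N ≃ₐ[ℚ] N) = ⊥ ∧ φ ∈ C) with hF
  have hcard := sum_log_le_card_mul_log' hx1.le F (Finset.filter_subset _ _)
  rw [div_le_iff₀ (by positivity)]
  rw [div_le_iff₀ (by positivity)] at hsum
  have : (∑ p ∈ F, Real.log p) * (2 * max (f₁ : ℝ) t) ≤ F.card * Real.log x * (2 * max (f₁ : ℝ) t) :=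
    mul_le_mul_of_nonneg_right hcard (by positivity)
  linarith

end OneSidedCount

end Summit.QuantumAdvantage.QuantumAdvantage.Theorems.DegreeOnePrimesEscape

end
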